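import Summits.BirchSwinnertonDyer.BirchSwinnertonDyer.Theorems.AdditiveBranchIMCGordTwoRankZeroDesc3Door
import Summits.BirchSwinnertonDyer.BirchSwinnertonDyer.Theorems.AdditiveBranchIMCGordTwoRankZeroCompanionThreeC493272x1
import Summits.BirchSwinnertonDyer.BirchSwinnertonDyer.Theorems.AdditiveBranchIMCGordTwoRankZeroCompanionThreeC499968bs1
import HarnessLib

/-!
# Route `AdditiveBranchIMC` (rung K1), crux `GordTwoRankZeroOffCaseOne` (item 19357, odd child 19245 ∋ `p = 3`) — DESC3 RECORDS part 181 (SECOND ROAD for gen-6 companion rows)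
# (2 classes: `493272x1`, `499968bs1`): `BSD(E,3)` per pair on (3, X4♯(G-ord, `e = 2`)) ∩ surj(3) ∩ `r_an = 0` ∩ `ord₃ #Ш_an = 2` rows from the register facts
# + ONE `3`-descent certificate line `Sel^(3)(E/ℚ) ≠ 0` (cell `bsd-addord`, seat `bsd-addord-k1-c2` gen 7, D-0074 row B1; planner KUR3-COVERAGE-v1 §2 road (R2))

HONEST FRAMING: nothing here proves BSD or the crux (OPEN at class level); THEOREMS ONLY (no definition, no named fact, no `sorry`); per pair /
per class; NOT a class theorem; nothing booked (booking is referee A's on the planner's offer). Each record instantiates the door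
`AdditiveBranchIMCGordTwoRankZeroDesc3.bsdp_rankZero_of_cellGordTwo_of_surj_of_selmerGroup_ne_bot` (file `…Desc3Door`, `p = 3`): LOWER half = the
native certificate `Sel^(3)(E/ℚ) ≠ 0` ⟹ `Ш(E)[3] ≠ 0` (rank `0` by GZK, `E(ℚ)[3] = 0` since `ρ̄₃` is onto) ⟹ `9 ∣ #Ш` (Cassels–Tate `hCT`) ⟹
`ord₃ #Ш_an ≤ 2 ≤ ord₃ #Ш`; UPPER half = gen 6's `…ThreeDoor` (Kato's component divisibility `hK` on the good ordinary twist, Delbourgo 1998 Prop. 4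
`hDel98`, GZK `hGZK`, modularity `hmod`/`hmodD`; the `3`-adic tower from `ρ̄₃` onto). IN THE KERNEL per record (REUSED from gen 6's landed companion modules `…CompanionThree[C]<E>` / `…Record<E>` / `…Models<E>`, imported —
not restated): `Δ ≠ 0` and global minimality of `W₀` and of its twist model `V` (`isElliptic_c<E>`, `isGloballyMinimal_c[V]<E>`), `goodOrd3_cV<E>`,
`ρ̄_{E,3}` ONTO (`surj_c<E>_3`);
cell membership `N10.CellGordTwo W 3` (`Addv`, `ord₃ j ≥ 0`, the explicit isomorphism `C • V^{(−3)} = W₀`, `V` good ORDINARY at `3` by its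
`𝔽₃`-point count, `e = 2` automatic at `3`). DISPLAYED binders: the register facts {hCT, hK, hDel98, hGZK, hmod, hmodD} (+ Cassels `hCassels` for the
class form), Cremona's `r_an = 0` (`hr0`) and `#Ш_an = q`, `ord₃ q ≤ 2` (`hq`, `hv`; the value is quoted per record), and the certificate line
`hSel : Sel^(3)(W₀/ℚ) ≠ ⊥` — EVIDENCE quoted per record: kit j274094 (this seat; bundle = bsd-potss k9-c2's j250472 BYTE-IDENTICAL: x11b Schaefer–Stoll
engine `desc3lib.gp` sha256 c4fb20b7…, driver `entry_k9.gp` 0e856d45… lower-bound mode, verifier `verify_k9.gp` 0d70349b… checks V0–V5; referee-reproduced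
as j250970): explicit, exactly verified elements of `Sel^(3)(W₀/ℚ)` in the octic algebra `A = ℚ[x]/(ψ₃)`. References: [Kato2004Asterisque] Thm. 17.4 (3) (p. 273);
[Delbourgo1998] Prop. 4 (p. 144); [Wuthrich2014] §3, App. B; [Greenberg1991] §2; [SilvermanAEC2009] Thm. X.4.2(a), X.4.14, VII.1 Rem. 1.1; [Kraus1989];
[Serre1972] §2; [SchaeferStoll2004]; [MilneADT2006] Thm. I.7.3; [Miller2011LMS] Def. 1.1; [Cremona2006] Table 1.
-/

set_option autoImplicit false

noncomputable section

open scoped Classical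

open WeierstrassCurve Literature.NumberTheory.EllipticCurves
  Literature.NumberTheory.EllipticCurves.Rank1Residual
  Literature.NumberTheory.EllipticCurves.Rank1Residual.Typed
  Literature.NumberTheory.EllipticCurves.Rank1Residual.X11RankOneCertificates
  Literature.NumberTheory.EllipticCurves.Wuthrich2014
  Literature.NumberTheory.EllipticCurves.ModularForms
  Literature.NumberTheory.GaloisRepresentations
  Summit.BirchSwinnertonDyer.BirchSwinnertonDyer.Rank1Residual.IntModel
  Summit.BirchSwinnertonDyer.Rank1Residual.X11b
  Summit.BirchSwinnertonDyer.Rank1Residual.GaloisImage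
  Summit.BirchSwinnertonDyer.Rank1Residual.Supersingular
  Summit.BirchSwinnertonDyer.Rank1Residual.SecondDescent
open NumberField IsDedekindDomain Rat.HeightOneSpectrum Field

set_option linter.dupNamespace false

namespace Summit.BirchSwinnertonDyer.BirchSwinnertonDyer.Theorems.AdditiveBranchIMCGordTwoRankZeroDesc3

open Summit.BirchSwinnertonDyer.Rank1Residual
open Summit.BirchSwinnertonDyer.Rank1Residual.Additive
open Summit.BirchSwinnertonDyer.BirchSwinnertonDyer.Theorems.AdditiveBranchIMCGordTwoRankZeroCompanion

/-! ### `493272x1` (class `493272x`, `N = 493272 = 2³·3²·13·17·31`; members: 493272x1 `#Ш_an = 9`, `#tors = 1`, `∏c = 2`) — second road; first road = gen 6's companion record `…CompanionThreeC493272x1` -/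

/-- **`BSD(E,3)` for `E = 493272x1`, SECOND (partner-free) ROAD** (`N = 493272`; Cremona: `r_an = 0`, `#Ш_an = 9`, `#tors = 1`, `∏ c_ℓ = 2`): door
`bsdp_rankZero_of_cellGordTwo_of_surj_of_selmerGroup_ne_bot` (LOWER half from `hSel` through Cassels–Tate; UPPER half `…ThreeDoor`); models, Kraus, `surj_c493272x1_3`,
`goodOrd3_cV493272x1` and the twist model = gen 6's landed declarations (imported); displayed: register facts, `hr0`/`hq`/`hv`, `hSel : Sel^(3)(E/ℚ) ≠ ⊥` — EVIDENCE
(kit j274094, x11b `desc3lib.gp` c4fb20b7…, row `493272x1`): `S = [2, 3, 13, 17, 31]`, `Cl(A) = [1, []]`, `21` generators of `A(S,3)`, `dim H¹(ℚ,E[3];S) = 5`, **`dim Sel^(3)(E/ℚ) ≥ 2`** (mode `LOWERBOUND(GRH)`, verifier `ALL-CHECKS-PASS`). Per pair; nothing booked. [cite: Kato2004Asterisque, Thm. 17.4 (3) (p. 273)] [cite: Delbourgo1998, Prop. 4 (p. 144)] [cite: SilvermanAEC2009, Thm. X.4.14] [cite: SchaeferStoll2004] [cite: Miller2011LMS, §1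 and Def. 1.1] -/
theorem bsdp_d493272x1_3
    (hCT : exists_casselsTate_pairing (K := ℚ)) (hK : Wuthrich2014.kato_halfEigenCharIdeal_dvd_cyclotomicPrime_of_surjective)
    (hDel98 : Delbourgo1998.prop4_rankZero_pow_dvd_constantCoeff) (hGZK : rank_eq_analyticRank_of_analyticRank_le_one)
    (hmod : hasEntireLFunction_rat) (hmodD : nonempty_modularParametrizationData)
    {W : WeierstrassCurve ℚ} [W.IsElliptic] [W.IsGloballyMinimal] (hWeq : W = ⟨0, 0, 0, -1119, -14510⟩)
    (hr0 : W.analyticRank = 0) {q : ℚ} (hq : shaAn W = (q : ℂ)) (hv : padicValRat 3 q ≤ 2)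
    (hSel : W.selmerGroup (3 : ℤ) ≠ ⊥) :
    BSDp W 3 := by
  haveI : Fact (Nat.Prime 3) := ⟨by norm_num⟩
  haveI := isElliptic_cV493272x1
  haveI := isGloballyMinimal_cV493272x1
  have hsurj : Surj W 3 := by rw [hWeq]; exact surj_c493272x1_3
  have hIW : integralModelInt W = (⟨0, 0, 0, -1119, -14510⟩ : WeierstrassCurve ℤ) :=
    integralModelInt_eq_of_map_eq _ (by rw [hWeq]; ext <;> simp [WeierstrassCurve.map])
  have hadd : Addv W 3 := Additive.addv_of_intModel hIW 3 (by decide +kernel) (by decide +kernel)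
  have hj : 0 ≤ padicValRat 3 W.j := padicValRat_j_nonneg_of_intModel hIW 3 2 (by decide +kernel) (by decide +kernel)
  have hWV : (⟨1, (1 : ℚ), (0 : ℚ), (0 : ℚ)⟩ : VariableChange ℚ) • (⟨0, 1, 0, -124, 496⟩ : WeierstrassCurve ℚ).quadraticTwist (-((3 : ℕ) : ℚ)) = W := by
    rw [hWeq]
    ext <;> simp [WeierstrassCurve.variableChange_a₁, WeierstrassCurve.variableChange_a₂,
      WeierstrassCurve.variableChange_a₃, WeierstrassCurve.variableChange_a₄, WeierstrassCurve.variableChange_a₆,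
      WeierstrassCurve.quadraticTwist, WeierstrassCurve.b₂, WeierstrassCurve.b₄, WeierstrassCurve.b₆] <;> norm_num
  have hG : TypeGOrd W 3 :=
    (typeGOrd_or_padicValRat_j_neg_of_twist_neg W 3 (by norm_num) (⟨0, 1, 0, -124, 496⟩ : WeierstrassCurve ℚ) ⟨_, hWV⟩
      (Or.inl goodOrd3_cV493272x1)).resolve_right (not_lt.mpr hj)
  have hc : N10.CellGordTwo W 3 := ⟨by norm_num, hadd, hG, semistabilityIndex_eq_two_of_typeG_three W hG.typeG hadd⟩
  exact bsdp_rankZero_of_cellGordTwo_of_surj_of_selmerGroup_ne_bot hCT hK hDel98 hGZK hmod hmodD hc hsurj hr0 hq hv hSel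

/-- **`BSD(E',3)` for every globally minimal `E'` `ℚ`-isogenous to `E = 493272x1`** (class `493272x`, 1 member), second road: Cassels' invariance
(`hCassels`, `N10.bsdp_of_isIsogenous_of_bsdp`) on `bsdp_d493272x1_3`. Per class; nothing booked. [cite: MilneADT2006, Thm. I.7.3 and Remark I.7.4] [cite: Kato2004Asterisque, Thm. 17.4 (3) (p. 273)] [cite: Delbourgo1998, Prop. 4 (p. 144)] [cite: SilvermanAEC2009, Thm. X.4.14] [cite: SchaeferStoll2004] [cite: Miller2011LMS, §1 and Def. 1.1] -/
theorem isogenous_bsdp_d493272x1_3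
    (hCassels : bsdRHS_eq_of_isIsogenous)
    (hCT : exists_casselsTate_pairing (K := ℚ)) (hK : Wuthrich2014.kato_halfEigenCharIdeal_dvd_cyclotomicPrime_of_surjective)
    (hDel98 : Delbourgo1998.prop4_rankZero_pow_dvd_constantCoeff) (hGZK : rank_eq_analyticRank_of_analyticRank_le_one)
    (hmod : hasEntireLFunction_rat) (hmodD : nonempty_modularParametrizationData)
    {W : WeierstrassCurve ℚ} [W.IsElliptic] [W.IsGloballyMinimal] (hWeq : W = ⟨0, 0, 0, -1119, -14510⟩)
    (hr0 : W.analyticRank = 0) {q : ℚ} (hq : shaAn W = (q : ℂ)) (hv : padicValRat 3 q ≤ 2)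
    (hSel : W.selmerGroup (3 : ℤ) ≠ ⊥)
    {W' : WeierstrassCurve ℚ} [W'.IsElliptic] [W'.IsGloballyMinimal] (hiso : IsIsogenous W' W) :
    BSDp W' 3 := by
  have hr' : W'.analyticRank ≤ 1 := by rw [analyticRank_eq_of_isIsogenous' hiso, hr0]; exact zero_le_one
  exact N10.bsdp_of_isIsogenous_of_bsdp 3 hCassels hGZK hmod hiso hr' (bsdp_d493272x1_3 hCT hK hDel98 hGZK hmod hmodD hWeq hr0 hq hv hSel)

/-! ### `499968bs1` (class `499968bs`, `N = 499968 = 2⁸·3²·7·31`; members: 499968bs1 `#Ш_an = 9`, `#tors = 1`, `∏c = 2`) — second road; first road = gen 6's companion record `…CompanionThreeC499968bs1` -/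

/-- **`BSD(E,3)` for `E = 499968bs1`, SECOND (partner-free) ROAD** (`N = 499968`; Cremona: `r_an = 0`, `#Ш_an = 9`, `#tors = 1`, `∏ c_ℓ = 2`): door
`bsdp_rankZero_of_cellGordTwo_of_surj_of_selmerGroup_ne_bot` (LOWER half from `hSel` through Cassels–Tate; UPPER half `…ThreeDoor`); models, Kraus, `surj_c499968bs1_3`,
`goodOrd3_cV499968bs1` and the twist model = gen 6's landed declarations (imported); displayed: register facts, `hr0`/`hq`/`hv`, `hSel : Sel^(3)(E/ℚ) ≠ ⊥` — EVIDENCE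
(kit j274094, x11b `desc3lib.gp` c4fb20b7…, row `499968bs1`): `S = [2, 3, 7, 31]`, `Cl(A) = [1, []]`, `12` generators of `A(S,3)`, `dim H¹(ℚ,E[3];S) = 2`, **`dim Sel^(3)(E/ℚ) ≥ 2`** (mode `LOWERBOUND(GRH)`, verifier `ALL-CHECKS-PASS`). Per pair; nothing booked. [cite: Kato2004Asterisque, Thm. 17.4 (3) (p. 273)] [cite: Delbourgo1998, Prop. 4 (p. 144)] [cite: SilvermanAEC2009, Thm. X.4.14] [cite: SchaeferStoll2004] [cite: Miller2011LMS, §1 and Def. 1.1] -/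
theorem bsdp_d499968bs1_3
    (hCT : exists_casselsTate_pairing (K := ℚ)) (hK : Wuthrich2014.kato_halfEigenCharIdeal_dvd_cyclotomicPrime_of_surjective)
    (hDel98 : Delbourgo1998.prop4_rankZero_pow_dvd_constantCoeff) (hGZK : rank_eq_analyticRank_of_analyticRank_le_one)
    (hmod : hasEntireLFunction_rat) (hmodD : nonempty_modularParametrizationData)
    {W : WeierstrassCurve ℚ} [W.IsElliptic] [W.IsGloballyMinimal] (hWeq : W = ⟨0, 0, 0, -303672, 74197888⟩)
    (hr0 : W.analyticRank = 0) {q : ℚ} (hq : shaAn W = (q : ℂ)) (hv : padicValRat 3 q ≤ 2)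
    (hSel : W.selmerGroup (3 : ℤ) ≠ ⊥) :
    BSDp W 3 := by
  haveI : Fact (Nat.Prime 3) := ⟨by norm_num⟩
  haveI := isElliptic_cV499968bs1
  haveI := isGloballyMinimal_cV499968bs1
  have hsurj : Surj W 3 := by rw [hWeq]; exact surj_c499968bs1_3
  have hIW : integralModelInt W = (⟨0, 0, 0, -303672, 74197888⟩ : WeierstrassCurve ℤ) :=
    integralModelInt_eq_of_map_eq _ (by rw [hWeq]; ext <;> simp [WeierstrassCurve.map])
  have hadd : Addv W 3 := Additive.addv_of_intModel hIW 3 (by decide +kernel) (by decide +kernel)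
  have hj : 0 ≤ padicValRat 3 W.j := padicValRat_j_nonneg_of_intModel hIW 3 2 (by decide +kernel) (by decide +kernel)
  have hWV : (⟨1, (1 : ℚ), (0 : ℚ), (0 : ℚ)⟩ : VariableChange ℚ) • (⟨0, 1, 0, -33741, -2759317⟩ : WeierstrassCurve ℚ).quadraticTwist (-((3 : ℕ) : ℚ)) = W := by
    rw [hWeq]
    ext <;> simp [WeierstrassCurve.variableChange_a₁, WeierstrassCurve.variableChange_a₂,
      WeierstrassCurve.variableChange_a₃, WeierstrassCurve.variableChange_a₄, WeierstrassCurve.variableChange_a₆,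
      WeierstrassCurve.quadraticTwist, WeierstrassCurve.b₂, WeierstrassCurve.b₄, WeierstrassCurve.b₆] <;> norm_num
  have hG : TypeGOrd W 3 :=
    (typeGOrd_or_padicValRat_j_neg_of_twist_neg W 3 (by norm_num) (⟨0, 1, 0, -33741, -2759317⟩ : WeierstrassCurve ℚ) ⟨_, hWV⟩
      (Or.inl goodOrd3_cV499968bs1)).resolve_right (not_lt.mpr hj)
  have hc : N10.CellGordTwo W 3 := ⟨by norm_num, hadd, hG, semistabilityIndex_eq_two_of_typeG_three W hG.typeG hadd⟩
  exact bsdp_rankZero_of_cellGordTwo_of_surj_of_selmerGroup_ne_bot hCT hK hDel98 hGZK hmod hmodD hc hsurj hr0 hq hv hSel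

/-- **`BSD(E',3)` for every globally minimal `E'` `ℚ`-isogenous to `E = 499968bs1`** (class `499968bs`, 1 member), second road: Cassels' invariance
(`hCassels`, `N10.bsdp_of_isIsogenous_of_bsdp`) on `bsdp_d499968bs1_3`. Per class; nothing booked. [cite: MilneADT2006, Thm. I.7.3 and Remark I.7.4] [cite: Kato2004Asterisque, Thm. 17.4 (3) (p. 273)] [cite: Delbourgo1998, Prop. 4 (p. 144)] [cite: SilvermanAEC2009, Thm. X.4.14] [cite: SchaeferStoll2004] [cite: Miller2011LMS, §1 and Def. 1.1] -/
theorem isogenous_bsdp_d499968bs1_3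
    (hCassels : bsdRHS_eq_of_isIsogenous)
    (hCT : exists_casselsTate_pairing (K := ℚ)) (hK : Wuthrich2014.kato_halfEigenCharIdeal_dvd_cyclotomicPrime_of_surjective)
    (hDel98 : Delbourgo1998.prop4_rankZero_pow_dvd_constantCoeff) (hGZK : rank_eq_analyticRank_of_analyticRank_le_one)
    (hmod : hasEntireLFunction_rat) (hmodD : nonempty_modularParametrizationData)
    {W : WeierstrassCurve ℚ} [W.IsElliptic] [W.IsGloballyMinimal] (hWeq : W = ⟨0, 0, 0, -303672, 74197888⟩)
    (hr0 : W.analyticRank = 0) {q : ℚ} (hq : shaAn W = (q : ℂ)) (hv : padicValRat 3 q ≤ 2)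
    (hSel : W.selmerGroup (3 : ℤ) ≠ ⊥)
    {W' : WeierstrassCurve ℚ} [W'.IsElliptic] [W'.IsGloballyMinimal] (hiso : IsIsogenous W' W) :
    BSDp W' 3 := by
  have hr' : W'.analyticRank ≤ 1 := by rw [analyticRank_eq_of_isIsogenous' hiso, hr0]; exact zero_le_one
  exact N10.bsdp_of_isIsogenous_of_bsdp 3 hCassels hGZK hmod hiso hr' (bsdp_d499968bs1_3 hCT hK hDel98 hGZK hmod hmodD hWeq hr0 hq hv hSel)

end Summit.BirchSwinnertonDyer.BirchSwinnertonDyer.Theorems.AdditiveBranchIMCGordTwoRankZeroDesc3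

end
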